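import Literature.NumberTheory.Automorphic.ModularLambdaSurjective
import HarnessLib

/-!
# Stub `stub_lambdaCompactPreimage` of the line `registered` (skeleton v5.1) for the crux
# `UniformAnalyticExtension` (stmt-CriticalPhenomena-6047, route `CardyUSTContinuation`)

λ-engine 2 of the Schottky reshaping (lead c4): every compact `K ⊆ ℂ ∖ {0, 1}` is covered by
`λ(K')` for a compact `K'` contained in the open upper half-plane, where `λ` is the modular
`λ`-function (`Literature.NumberTheory.Automorphic.modularLambda`).

Proof (pure topology on top of two Literature facts): `λ` is onto `ℂ ∖ {0, 1}`
(`exists_modularLambda_eq`), so every `w ∈ K` has a lift `τ_w` with `0 < Im τ_w`; the disc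
`ball τ_w (Im τ_w / 2)` lies in the upper half-plane, so its image `U_w` under `λ` is open
(`isOpen_image_modularLambda`, the open mapping theorem) and contains `w`.  A finite subfamily
`U_{w_1}, …, U_{w_n}` covers `K`, and `K' := ⋃ᵢ closedBall τ_{w_i} (Im τ_{w_i} / 2)` works: it is
compact (finite union of closed discs in the proper space `ℂ`), it lies in `{0 < Im}` (on the closed
disc `Im z ≥ Im τ_{w_i} / 2 > 0`), and every `w ∈ K` is `λ τ` with `τ` in some open disc
`ball τ_{w_i} (Im τ_{w_i} / 2) ⊆ K'`.
-/

noncomputable section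

open Filter Topology Set Metric

open Literature.NumberTheory.Automorphic (modularLambda)

namespace Summit.CriticalPhenomena.CardyFormulaZ2.Cruxes.UniformAnalyticExtension.Birth

/-- On the closed disc of radius `Im τ / 2` about a point `τ` of the upper half-plane the imaginary
part is at least `Im τ / 2`. [folklore] -/
theorem compactPreimage_half_im_le_of_mem_closedBall {τ z : ℂ}
    (hz : z ∈ closedBall τ (τ.im / 2)) : τ.im / 2 ≤ z.im := by
  rw [mem_closedBall, dist_eq_norm] at hz
  have h : |(z - τ).im| ≤ ‖z - τ‖ := Complex.abs_im_le_norm (z - τ)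
  rw [Complex.sub_im] at h
  have h' := (abs_le.mp (h.trans hz)).1
  linarith

/-- The closed disc of radius `Im τ / 2` about a point `τ` with `0 < Im τ` lies in the open upper
half-plane. [folklore] -/
theorem compactPreimage_closedBall_subset_upperHalfPlane {τ : ℂ} (hτ : 0 < τ.im) :
    closedBall τ (τ.im / 2) ⊆ {z : ℂ | 0 < z.im} := fun _ hz =>
  lt_of_lt_of_le (half_pos hτ) (compactPreimage_half_im_le_of_mem_closedBall hz)

/-- The open disc of radius `Im τ / 2` about a point `τ` with `0 < Im τ` lies in the open upper
half-plane. [folklore] -/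
theorem compactPreimage_ball_subset_upperHalfPlane {τ : ℂ} (hτ : 0 < τ.im) :
    ball τ (τ.im / 2) ⊆ {z : ℂ | 0 < z.im} :=
  ball_subset_closedBall.trans (compactPreimage_closedBall_subset_upperHalfPlane hτ)

open Literature.NumberTheory.Automorphic.ModularLambda in
/-- **stub_lambdaCompactPreimage** (λ-engine 2): every compact `K ⊆ ℂ ∖ {0, 1}` is covered by the
image under the modular function `λ` of a compact subset `K'` of the open upper half-plane.
(`λ` is onto `ℂ ∖ {0,1}` and open, so `K` is covered by finitely many images of discs
`ball τ (Im τ / 2) ⊆ ℍ`; take `K'` the union of the corresponding closed discs.) [folklore] -/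
theorem stub_lambdaCompactPreimage :
    ∀ K : Set ℂ, IsCompact K → (∀ w ∈ K, w ≠ 0 ∧ w ≠ 1) →
      ∃ K' : Set ℂ, IsCompact K' ∧ (∀ τ ∈ K', 0 < τ.im) ∧
        ∀ w ∈ K, ∃ τ ∈ K', modularLambda τ = w := by
  intro K hK hK01
  -- a lift `sec w ∈ ℍ` of every `w ∈ K`
  have hsec : ∀ w : K, ∃ τ : ℂ, 0 < τ.im ∧ modularLambda τ = w := fun w =>
    exists_modularLambda_eq (hK01 w w.2).1 (hK01 w w.2).2
  choose sec hsec_im hsec_eq using hsec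
  -- the open cover of `K` by images of half-height discs
  set U : K → Set ℂ := fun w => modularLambda '' ball (sec w) ((sec w).im / 2)
  have hUo : ∀ w, IsOpen (U w) := fun w =>
    isOpen_image_modularLambda (compactPreimage_ball_subset_upperHalfPlane (hsec_im w)) isOpen_ball
  have hKU : K ⊆ ⋃ w, U w := fun w hw =>
    mem_iUnion.2 ⟨⟨w, hw⟩, sec ⟨w, hw⟩, mem_ball_self (half_pos (hsec_im _)), hsec_eq ⟨w, hw⟩⟩
  obtain ⟨t, ht⟩ := hK.elim_finite_subcover U hUo hKU
  refine ⟨⋃ w ∈ t, closedBall (sec w) ((sec w).im / 2),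
    t.isCompact_biUnion fun w _ => isCompact_closedBall _ _, ?_, ?_⟩
  · intro τ hτ
    obtain ⟨w, -, hτw⟩ := mem_iUnion₂.1 hτ
    exact compactPreimage_closedBall_subset_upperHalfPlane (hsec_im w) hτw
  · intro w hw
    obtain ⟨i, hi, hwi⟩ := mem_iUnion₂.1 (ht hw)
    obtain ⟨τ, hτ, hτw⟩ := hwi
    exact ⟨τ, mem_iUnion₂.2 ⟨i, hi, ball_subset_closedBall hτ⟩, hτw⟩

end Summit.CriticalPhenomena.CardyFormulaZ2.Cruxes.UniformAnalyticExtension.Birth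

end
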